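import Literature.Geometry.Kaehler.ComplexTorusHyperplaneRestriction
import Literature.LinearAlgebra.QuadraticForm.SignatureContinuousFamily
import Literature.Geometry.Kaehler.ComplexTorusTranscendentalLatticeSignature
import Literature.Geometry.Kaehler.ComplexTorusIntersectionFormSignature
import HarnessLib

/-!
# The mixed Hodge–Riemann form `(A, B) ↦ Re(ε · ∫_X Ω ∧ A ∧ B̄)` on `Λ^{p,q}` as a real symmetric bilinear form:
# symmetry, continuity in the background, non-degeneracy from mixed hard Lefschetz, the indices of inertia along
# the mixed Lefschetz decomposition, and the classical (positive definite) point

Layer `Literature/Geometry/Kaehler`, namespace `Literature.Geometry.Kaehler.ComplexTorus`; lane `lit-hodgefound`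
(Track 2, HodgeConjecture), file T4a of the programme "mixed Hodge–Riemann bilinear relations in every bidegree on a
complex torus" (T1 = `LinearAlgebra/QuadraticForm/SignatureContinuousFamily` — signatures are locally constant along
continuous non-degenerate families; T2 = `ComplexTorusMixedLefschetzDecomposition`; T3 =
`ComplexTorusHyperplaneRestriction`). This file packages Dinh–Nguyên's "sesquilinear Hermitian symmetric form"
`Q(α, β) = ε ∗(α ∧ β̄ ∧ Ω)` (Prop. 2.1) on the constant forms of a complex torus `X = E/Λ` as the object the
deformation argument acts on: a REAL symmetric bilinear form on `Λ^{p,q}` (read as a real vector space) whose indices of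
inertia T1 follows along the convex cone of positive backgrounds. Definitions have bodies; no named facts.

## Contents

* §1 the sign `ε(k,p,q) = (-1)^{C(k,2)} i^p (-i)^q` (`= (-1)^{k(k-1)/2} i^{p-q}`, Voisin's Thm. 6.32): `ε ≠ 0`,
  `conj ε = (-1)^k ε` (`k = p + q`), `ε(k+2, p+1, q+1) = -ε(k, p, q)`;
* §2 `hrPairing`: `H_Ω(A, B) = ε ∫_X Ω ∧ A ∧ B̄` — `ℂ`-linear / conjugate-linear, **Hermitian** for a real
  background `Ω` (`H(B, A) = conj H(A, B)`, so `H(A, A) ∈ ℝ`); `hrForm`: its real part as a `LinearMap.BilinForm ℝ`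
  on complex `k`-forms, symmetric; `h(A, ·) = 0` on a complex subspace forces `H(A, ·) = 0` there;
* §3 `hrFormPQ`: the restriction to `Λ^{p,q}`; **non-degenerate** (radical `⊥`) when `Ω = θ_1 ∧ ⋯ ∧ θ_n` satisfies
  mixed hard Lefschetz on `Λ^{p,q}` (T2's `eq_zero_of_forall_torusIntegral_wedge_conjForm_eq_zero`);
* §4 **continuity** of `θ ↦ h_{Ω(θ)}(A, B)` for `Ω(θ) = (-θ_1)_ℂ ∧ ⋯ ∧ (-θ_n)_ℂ` (`∧` is a continuous bilinear map,
  tree `wedgeCLM`);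
* §5 `b^±(Q) = b^±(Q|W₁) + b^±(Q|W₂)` for a `Q`-orthogonal splitting of a non-degenerate symmetric form (Sylvester;
  tree `sigPos_restrict_add_sigPos_restrict_le`);
* §6 the mixed Lefschetz decomposition over `ℝ`: `primitiveReal` (`P_Θ ∩ Λ^{p+1,q+1}`) and `lefschetzReal`
  (`ω ∧ Λ^{p,q}`) are complementary (T2) and `h`-orthogonal, hence
  **`b^±(h) = b^±(h|_P) + b^±(h|_{ω ∧ Λ^{p,q}})`** (`sigPos_sigNeg_hrFormPQ_eq_add`);
* §7 `C ↦ C ∧ ω` is an isometry of `(Λ^{p,q}, h_{(θ_0,…,θ_n,θ_n)})` onto `(ω ∧ Λ^{p,q}, h_{(θ_0,…,θ_{n-1})})`, so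
  **`b^±(h|_{ω ∧ Λ^{p,q}}) = b^±(h^{(p+q)}_{(θ_0,…,θ_n,θ_n)})`** (`sigPos_sigNeg_restrict_lefschetzReal_eq`);
* §8 **the classical point**: for the constant background of one positive `(1,1)`-form, `h` with the sign
  `ε(k,p,q)` is positive definite on the primitive forms (Voisin's Thm. 6.32; tree `hodgeRiemann_voisin_of_pos`);
* §9 real dimensions (`dim_ℝ = 2 dim_ℂ`; `dim_ℝ P ∩ Λ^{p+1,q+1} = 2(C(g,p+1)C(g,q+1) - C(g,p)C(g,q))` from T2), and
  the bidegrees `(0,q)`, `(p,0)` in which every form is primitive;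
* §10 `ε ↦ -ε`, and `ε (Ω ∧ A ∧ Ā)(u_1, iu_1, …) > 0 ⟺ H(A, A) > 0 ⟺ h(A, A) > 0` for every complex basis `u`
  (the lattice-free "frame form" of the Hodge–Riemann inequality used by T3's hyperplane step).

Technical note: statements about `sigPos` / `radical` of forms whose carrier is a `Submodule` coerced to a type
need `set_option maxSynthPendingDepth 3` (as in `ComplexTorusMixedHodgeIndexSemipositiveSignature`); the real
structure on complex-valued forms is the pointwise one (`ContinuousAlternatingMap.instModule`), finite-dimensional
over `ℝ` by `Module.Finite.trans ℂ`.

## Sources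

* T.-C. Dinh, V.-A. Nguyên, *The mixed Hodge–Riemann bilinear relations for compact Kähler manifolds*, GAFA 16
  (2006), §2 Prop. 2.1 (the form `Q`, "sesquilinear Hermitian symmetric"; (a) mixed hard Lefschetz, (b) positivity
  on `P^{p,q}`, (c) the `Q`-orthogonal splitting; arXiv PDF p. 5), §1 Thm. 1.3. [DinhNguyen2006]
* V. A. Timorin, *Mixed Hodge–Riemann bilinear relations in a linear context*, Funct. Anal. Appl. 32 (1998) —
  Main Theorem (cited through Dinh–Nguyên). [Timorin1998]
* E. Cattani, *Mixed Lefschetz theorems and Hodge–Riemann bilinear relations*, IMRN 2008, §2 Def. 2.1 / Thm. 2.2.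
  [Cattani2008MixedLefschetz]
* C. Voisin, *Hodge Theory and Complex Algebraic Geometry I* (2002), §6.3.2 Thm. 6.32 (the sign
  `(-1)^{k(k-1)/2} i^{p-q}`) and Rem. 6.34, §6.2.3. [VoisinHodgeI2002]
* J. Gregory, *Quadratic Form Theory and Differential Equations* (1980), Ch. 2 §2.2 Thm. 12 / Thm. 14, §2.3
  Thm. 5, Cor. 8 (continuous families; chunks p0077–p0087). [Gregory1980QuadraticForms]
* J.-P. Serre, *A Course in Arithmetic* (1973), Ch. IV §2.4 (Sylvester). [Serre1973]
* H. Lange, *Abelian Varieties over the Complex Numbers* (2023), §1.1.3 Cor. 1.1.19, §1.1.5 Prop. 1.1.23, §1.7.2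
  Lemma 1.7.5, §2.2.1 Lemma 2.2.2. [Lange2023AbelianVarietiesComplex]
* F. W. Warner, *Foundations of Differentiable Manifolds and Lie Groups*, GTM 94, 2.6. [WarnerGTM94]
-/

noncomputable section

set_option maxSynthPendingDepth 3

open scoped ComplexConjugate ComplexOrder
open Complex Function Module
open Literature.LinearAlgebra.Alternating
open Literature.Analysis.Complex (oneForm₀ IsOfTypeAt typeSubmodule isOfTypeAt_of_mem_typeSubmodule)
open Literature.NumberTheory.Transcendental (wedgeCLM wedgeCLM_apply)

namespace Literature.Geometry.Kaehler

namespace ComplexTorus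

/-! ## §1 Voisin's sign `ε(k,p,q) = (-1)^{k(k-1)/2} i^{p-q}` -/

section Sign

/-- **The Hodge–Riemann sign** `ε(k,p,q) = (-1)^{k(k-1)/2} i^{p-q}` in front of `∫_X ω^{n-k} ∧ α ∧ ᾱ` (Voisin's
Thm. 6.32; `i^{p-q} = i^p (-i)^q`, `k(k-1)/2 = C(k,2)`). [cite: VoisinHodgeI2002, §6.3.2 Thm. 6.32] -/
def hrSign (k p q : ℕ) : ℂ := (-1) ^ (k.choose 2) * (I ^ p * (-I) ^ q)

/-- `ε(k,p,q) ≠ 0`. [cite: VoisinHodgeI2002, §6.3.2 Thm. 6.32] -/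
theorem hrSign_ne_zero (k p q : ℕ) : hrSign k p q ≠ 0 :=
  mul_ne_zero (pow_ne_zero _ (neg_ne_zero.2 one_ne_zero))
    (mul_ne_zero (pow_ne_zero _ I_ne_zero) (pow_ne_zero _ (neg_ne_zero.2 I_ne_zero)))

/-- `ε(k,p,q)` agrees with the exponent form `(-1)^{k(k-1)/2} i^{p-q}` used by `hodgeRiemann_voisin_of_pos`.
[cite: VoisinHodgeI2002, §6.3.2 Thm. 6.32] -/
theorem hrSign_eq_zpow (k p q : ℕ) : hrSign k p q = (-1) ^ (k * (k - 1) / 2) * I ^ ((p : ℤ) - q) := by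
  rw [hrSign, Nat.choose_two_right, zpow_sub₀ I_ne_zero, zpow_natCast, zpow_natCast, div_eq_mul_inv, ← inv_pow,
    Complex.inv_I]

/-- **`conj ε = (-1)^k ε`** for `k = p + q` (`conj i^{p-q} = (-i)^{p-q} = (-1)^{p+q} i^{p-q}`): the source of the
Hermitian symmetry of the Hodge–Riemann form. [cite: DinhNguyen2006, §2 Prop. 2.1 ("sesquilinear Hermitian symmetric form"; arXiv PDF p. 5)] -/
theorem conj_hrSign {k p q : ℕ} (hpq : p + q = k) : conj (hrSign k p q) = (-1) ^ k * hrSign k p q := by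
  unfold hrSign
  rw [map_mul, map_mul, map_pow, map_pow, map_pow, map_neg, map_one, map_neg, Complex.conj_I, neg_neg, ← hpq,
    pow_add]
  have h1 : (-I) ^ p = (-1) ^ p * I ^ p := by rw [← neg_one_mul, mul_pow]
  have h2 : (-I) ^ q = (-1) ^ q * I ^ q := by rw [← neg_one_mul, mul_pow]
  rw [h1, h2]
  have h3 : ((-1 : ℂ) ^ q) * (-1) ^ q = 1 := by rw [← mul_pow, neg_one_mul, neg_neg, one_pow]
  linear_combination (-((-1 : ℂ) ^ (p + q).choose 2 * (-1) ^ p * I ^ p * I ^ q)) * h3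

/-- **`ε(k+2, p+1, q+1) = -ε(k, p, q)`**: the sign flips from `Λ^{p,q}` to `ω ∧ Λ^{p,q} ⊆ Λ^{p+1,q+1}` — the
alternation of signs along the Lefschetz decomposition. [cite: VoisinHodgeI2002, §6.3.2 Thm. 6.32 and Rem. 6.34] -/
theorem hrSign_succ_succ (k p q : ℕ) : hrSign (k + 2) (p + 1) (q + 1) = -hrSign k p q := by
  unfold hrSign
  have hc : (k + 2).choose 2 = k.choose 2 + (2 * k + 1) := by
    have h1 : (k + 2).choose 2 = (k + 1) + (k + 1).choose 2 := by
      have h := Nat.choose_succ_succ (k + 1) 1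
      rw [Nat.choose_one_right] at h
      exact h
    have h2 : (k + 1).choose 2 = k + k.choose 2 := by
      have h := Nat.choose_succ_succ k 1
      rw [Nat.choose_one_right] at h
      exact h
    omega
  rw [hc, pow_add, Odd.neg_one_pow ⟨k, rfl⟩, pow_succ, pow_succ]
  linear_combination ((-1 : ℂ) ^ k.choose 2 * I ^ p * (-I) ^ q) * Complex.I_mul_I

end Sign

/-! ## §2 The complex pairing `H(A, B) = ε ∫_X Ω ∧ A ∧ B̄` and its real part as a bilinear form -/

section Form

variable {ι : Type*} [DecidableEq ι] {E : Type*} [NormedAddCommGroup E] [NormedSpace ℂ E]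
  (Φ : (ι → ℝ) ≃L[ℝ] E) {g n k : ℕ}

/-- **The mixed Hodge–Riemann pairing** `H_Ω(A, B) := ε · ∫_X Ω ∧ A ∧ B̄` of a background `Ω` (degree `2n`) on
`k`-forms, `2n + 2k = 2g` (Dinh–Nguyên's `Q(α, β) = ε ∗(α ∧ β̄ ∧ Ω)`, integrated; `Ω` of even degree commutes to
the front). [cite: DinhNguyen2006, §2 Prop. 2.1 (arXiv PDF p. 5)] [cite: Timorin1998, Main Theorem] -/
def hrPairing (e : Fin (2 * g) ≃ ι) (σ : ℂ) (Ω : E [⋀^Fin (2 * n)]→L[ℝ] ℂ) (h2 : 2 * n + (k + k) = 2 * g)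
    (A B : E [⋀^Fin k]→L[ℝ] ℂ) : ℂ :=
  σ * torusIntegral Φ e ((Ω.wedge (A.wedge (conjForm B))).domDomCongr (finCongr h2))

variable (e : Fin (2 * g) ≃ ι) (σ : ℂ) (Ω : E [⋀^Fin (2 * n)]→L[ℝ] ℂ) (h2 : 2 * n + (k + k) = 2 * g)

/-- Unfolding. [cite: DinhNguyen2006, §2 Prop. 2.1 (arXiv PDF p. 5)] -/
theorem hrPairing_apply (A B : E [⋀^Fin k]→L[ℝ] ℂ) : hrPairing Φ e σ Ω h2 A B =
    σ * torusIntegral Φ e ((Ω.wedge (A.wedge (conjForm B))).domDomCongr (finCongr h2)) := rfl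

/-- `∫` of a reindexed form, on the lattice frame. [folklore] -/
private theorem torusIntegral_domDomCongr_latticeFrame {N N' : ℕ} (e' : Fin N' ≃ ι) (h : N = N')
    (X : E [⋀^Fin N]→L[ℝ] ℂ) :
    torusIntegral Φ e' (X.domDomCongr (finCongr h)) = (orientationSign Φ e' : ℂ) * X (latticeFrame Φ e' ∘ Fin.cast h) :=
  rfl

/-- `H` is additive in the first slot. [cite: DinhNguyen2006, §2 Prop. 2.1 (arXiv PDF p. 5)] -/
theorem hrPairing_add_left (A A' B : E [⋀^Fin k]→L[ℝ] ℂ) :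
    hrPairing Φ e σ Ω h2 (A + A') B = hrPairing Φ e σ Ω h2 A B + hrPairing Φ e σ Ω h2 A' B := by
  simp only [hrPairing, torusIntegral_domDomCongr_latticeFrame, ContinuousAlternatingMap.wedge_add_left,
    ContinuousAlternatingMap.wedge_add_right, ContinuousAlternatingMap.add_apply]
  ring

/-- `H` is additive in the second slot. [cite: DinhNguyen2006, §2 Prop. 2.1 (arXiv PDF p. 5)] -/
theorem hrPairing_add_right (A B B' : E [⋀^Fin k]→L[ℝ] ℂ) :
    hrPairing Φ e σ Ω h2 A (B + B') = hrPairing Φ e σ Ω h2 A B + hrPairing Φ e σ Ω h2 A B' := by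
  simp only [hrPairing, torusIntegral_domDomCongr_latticeFrame, conj_add, ContinuousAlternatingMap.wedge_add_right,
    ContinuousAlternatingMap.add_apply]
  ring

/-- `H` is `ℂ`-linear in the first slot. [cite: DinhNguyen2006, §2 Prop. 2.1 (arXiv PDF p. 5)] -/
theorem hrPairing_smul_left (c : ℂ) (A B : E [⋀^Fin k]→L[ℝ] ℂ) :
    hrPairing Φ e σ Ω h2 (c • A) B = c * hrPairing Φ e σ Ω h2 A B := by
  rw [hrPairing_apply, hrPairing_apply, wedge_smul_left_complex, wedge_smul_right_complex, domDomCongr_finCongr_smul,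
    torusIntegral_smul]
  ring

/-- `H` is conjugate-linear in the second slot. [cite: DinhNguyen2006, §2 Prop. 2.1 (arXiv PDF p. 5)] -/
theorem hrPairing_smul_right (c : ℂ) (A B : E [⋀^Fin k]→L[ℝ] ℂ) :
    hrPairing Φ e σ Ω h2 A (c • B) = conj c * hrPairing Φ e σ Ω h2 A B := by
  rw [hrPairing_apply, hrPairing_apply, conj_smul, wedge_smul_right_complex, wedge_smul_right_complex,
    domDomCongr_finCongr_smul, torusIntegral_smul]
  ring

/-- Real scalars act as complex scalars on complex-valued forms. [folklore] -/
private theorem real_smul_eq_coe_smul {m : ℕ} (r : ℝ) (A : E [⋀^Fin m]→L[ℝ] ℂ) : r • A = (r : ℂ) • A := by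
  ext v; simp only [ContinuousAlternatingMap.smul_apply, Complex.real_smul, smul_eq_mul]

/-- `(-1)^{k·k} = (-1)^k`. [folklore] -/
private theorem neg_one_pow_mul_self (k : ℕ) : ((-1 : ℝ) ^ (k * k)) = (-1) ^ k := by
  rcases Nat.even_or_odd k with hk | hk
  · rw [hk.neg_one_pow, (hk.mul_right k).neg_one_pow]
  · rw [hk.neg_one_pow, (Nat.odd_mul.2 ⟨hk, hk⟩).neg_one_pow]

/-- **Hermitian symmetry `H(B, A) = conj H(A, B)`** for a REAL background `Ω` (`Ω̄ = Ω`) and a sign with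
`conj ε = (-1)^k ε`: `conj ∫ Ω ∧ A ∧ B̄ = ∫ Ω ∧ Ā ∧ B = (-1)^{k²} ∫ Ω ∧ B ∧ Ā` (Dinh–Nguyên: "the sesquilinear
Hermitian symmetric form `Q`"). [cite: DinhNguyen2006, §2 Prop. 2.1 (arXiv PDF p. 5)] -/
theorem hrPairing_swap (hΩ : conjForm Ω = Ω) (hσ : conj σ = (-1) ^ k * σ) (A B : E [⋀^Fin k]→L[ℝ] ℂ) :
    hrPairing Φ e σ Ω h2 B A = conj (hrPairing Φ e σ Ω h2 A B) := by
  have hI : torusIntegral Φ e ((Ω.wedge ((conjForm A).wedge B)).domDomCongr (finCongr h2)) =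
      (-1) ^ k * torusIntegral Φ e ((Ω.wedge (B.wedge (conjForm A))).domDomCongr (finCongr h2)) := by
    rw [ContinuousAlternatingMap.WedgeComm_holds ℝ E ℂ B (conjForm A), domDomCongr_finCongr_self,
      ContinuousAlternatingMap.wedge_smul_right, domDomCongr_finCongr_smul, neg_one_pow_mul_self,
      real_smul_eq_coe_smul, torusIntegral_smul]
    push_cast
    ring
  have h1 : ((-1 : ℂ) ^ k) * (-1) ^ k = 1 := by rw [← mul_pow, neg_one_mul, neg_neg, one_pow]
  rw [hrPairing_apply, hrPairing_apply, map_mul, ← torusIntegral_conjForm, conjForm_domDomCongr_finCongr, conj_wedge,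
    conj_wedge, hΩ, Literature.LinearAlgebra.Alternating.conj_conj, hσ, hI]
  linear_combination (-(σ * torusIntegral Φ e (ContinuousAlternatingMap.domDomCongr (finCongr h2)
    (Ω.wedge (B.wedge (conjForm A)))))) * h1

/-- Hence **`H(A, A)` is real**. [cite: DinhNguyen2006, §2 Prop. 2.1 (arXiv PDF p. 5)] -/
theorem hrPairing_self_im (hΩ : conjForm Ω = Ω) (hσ : conj σ = (-1) ^ k * σ) (A : E [⋀^Fin k]→L[ℝ] ℂ) :
    (hrPairing Φ e σ Ω h2 A A).im = 0 := by
  have h := hrPairing_swap Φ e σ Ω h2 hΩ hσ A A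
  exact Complex.conj_eq_iff_im.1 h.symm

/-- **The real mixed Hodge–Riemann form `h_Ω(A, B) := Re H_Ω(A, B)`**, a real bilinear form on the real vector
space of complex-valued `k`-forms (the form whose indices of inertia the deformation argument follows).
[cite: DinhNguyen2006, §2 Prop. 2.1 (arXiv PDF p. 5)] [cite: Gregory1980QuadraticForms, Ch. 2 §2.3 (chunk p0086)] -/
def hrForm : LinearMap.BilinForm ℝ (E [⋀^Fin k]→L[ℝ] ℂ) :=
  LinearMap.mk₂ ℝ (fun A B ↦ (hrPairing Φ e σ Ω h2 A B).re)
    (fun A A' B ↦ by simp only [hrPairing_add_left, Complex.add_re])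
    (fun c A B ↦ by
      simp only [real_smul_eq_coe_smul, hrPairing_smul_left, Complex.re_ofReal_mul, smul_eq_mul])
    (fun A B B' ↦ by simp only [hrPairing_add_right, Complex.add_re])
    (fun c A B ↦ by
      simp only [real_smul_eq_coe_smul, hrPairing_smul_right, Complex.conj_ofReal, Complex.re_ofReal_mul, smul_eq_mul])

/-- Unfolding. [cite: DinhNguyen2006, §2 Prop. 2.1 (arXiv PDF p. 5)] -/
@[simp] theorem hrForm_apply (A B : E [⋀^Fin k]→L[ℝ] ℂ) :
    hrForm Φ e σ Ω h2 A B = (hrPairing Φ e σ Ω h2 A B).re := rfl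

/-- **`h_Ω` is symmetric** (real part of a Hermitian form). [cite: DinhNguyen2006, §2 Prop. 2.1 (arXiv PDF p. 5)] -/
theorem hrForm_isSymm (hΩ : conjForm Ω = Ω) (hσ : conj σ = (-1) ^ k * σ) : (hrForm Φ e σ Ω h2).IsSymm :=
  ⟨fun A B ↦ by rw [hrForm_apply, hrForm_apply, hrPairing_swap Φ e σ Ω h2 hΩ hσ A B, Complex.conj_re]⟩

/-- `H(A, A) = h(A, A)` (as a complex number). [cite: DinhNguyen2006, §2 Prop. 2.1 (arXiv PDF p. 5)] -/
theorem hrPairing_self_eq (hΩ : conjForm Ω = Ω) (hσ : conj σ = (-1) ^ k * σ) (A : E [⋀^Fin k]→L[ℝ] ℂ) :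
    hrPairing Φ e σ Ω h2 A A = ((hrForm Φ e σ Ω h2 A A : ℝ) : ℂ) := by
  apply Complex.ext
  · rw [hrForm_apply, Complex.ofReal_re]
  · rw [hrPairing_self_im Φ e σ Ω h2 hΩ hσ, Complex.ofReal_im]

/-- **`h(A, ·) = 0` on a complex subspace forces `H(A, ·) = 0` there** (test against `B` and `iB`:
`H(A, iB) = -i H(A, B)`). [cite: DinhNguyen2006, §2 Prop. 2.1 (arXiv PDF p. 5)] -/
theorem hrPairing_eq_zero_of_forall_re_eq_zero {U : Submodule ℂ (E [⋀^Fin k]→L[ℝ] ℂ)} {A : E [⋀^Fin k]→L[ℝ] ℂ}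
    (h : ∀ B ∈ U, hrForm Φ e σ Ω h2 A B = 0) {B : E [⋀^Fin k]→L[ℝ] ℂ} (hB : B ∈ U) :
    hrPairing Φ e σ Ω h2 A B = 0 := by
  have h1 := h B hB
  have h2' := h (I • B) (U.smul_mem I hB)
  rw [hrForm_apply] at h1 h2'
  rw [hrPairing_smul_right, Complex.conj_I, neg_mul, Complex.neg_re, Complex.I_mul_re, neg_neg] at h2'
  exact Complex.ext h1 h2'

/-- Hence **`∫_X Ω ∧ A ∧ B̄ = 0` on the subspace** when `ε ≠ 0`. [cite: DinhNguyen2006, §2 Prop. 2.1 (arXiv PDF p. 5)] -/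
theorem torusIntegral_eq_zero_of_forall_hrForm_eq_zero (hσ0 : σ ≠ 0) {U : Submodule ℂ (E [⋀^Fin k]→L[ℝ] ℂ)}
    {A : E [⋀^Fin k]→L[ℝ] ℂ} (h : ∀ B ∈ U, hrForm Φ e σ Ω h2 A B = 0) {B : E [⋀^Fin k]→L[ℝ] ℂ} (hB : B ∈ U) :
    torusIntegral Φ e ((Ω.wedge (A.wedge (conjForm B))).domDomCongr (finCongr h2)) = 0 := by
  have h0 := hrPairing_eq_zero_of_forall_re_eq_zero Φ e σ Ω h2 h hB
  rw [hrPairing_apply] at h0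
  exact (mul_eq_zero.1 h0).resolve_left hσ0

end Form

/-! ## §3 The form on `Λ^{p,q}`; non-degeneracy from mixed hard Lefschetz -/

section Restrict

variable {ι : Type*} [Fintype ι] [DecidableEq ι] {E : Type*} [NormedAddCommGroup E] [NormedSpace ℂ E]
  (Φ : (ι → ℝ) ≃L[ℝ] E) {g n k : ℕ} (e : Fin (2 * g) ≃ ι) (σ : ℂ) (Ω : E [⋀^Fin (2 * n)]→L[ℝ] ℂ)
  (h2 : 2 * n + (k + k) = 2 * g) (p q : ℕ)

/-- **The real mixed Hodge–Riemann form on `Λ^{p,q}`** (as a real vector space): the restriction of `h_Ω`.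
[cite: DinhNguyen2006, §2 Prop. 2.1 (arXiv PDF p. 5)] [cite: Timorin1998, Main Theorem] -/
def hrFormPQ : LinearMap.BilinForm ℝ ↥((typeSubmodule E k p q).restrictScalars ℝ) :=
  (hrForm Φ e σ Ω h2).restrict _

omit [Fintype ι] in
/-- Unfolding. [cite: DinhNguyen2006, §2 Prop. 2.1 (arXiv PDF p. 5)] -/
@[simp] theorem hrFormPQ_apply (A B : ↥((typeSubmodule E k p q).restrictScalars ℝ)) :
    hrFormPQ Φ e σ Ω h2 p q A B = (hrPairing Φ e σ Ω h2 A B).re := rfl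

omit [Fintype ι] in
/-- `h_Ω|_{Λ^{p,q}}` is symmetric. [cite: DinhNguyen2006, §2 Prop. 2.1 (arXiv PDF p. 5)] -/
theorem hrFormPQ_isSymm (hΩ : conjForm Ω = Ω) (hσ : conj σ = (-1) ^ k * σ) : (hrFormPQ Φ e σ Ω h2 p q).IsSymm :=
  ⟨fun A B ↦ (hrForm_isSymm Φ e σ Ω h2 hΩ hσ).eq A B⟩

omit [Fintype ι] in
/-- The quadratic form of `h_Ω|_{Λ^{p,q}}` is `A ↦ H(A, A)` (a real number). [cite: DinhNguyen2006, §2 Prop. 2.1 (arXiv PDF p. 5)] -/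
theorem hrFormPQ_toQuadraticMap_apply (A : ↥((typeSubmodule E k p q).restrictScalars ℝ)) :
    (hrFormPQ Φ e σ Ω h2 p q).toQuadraticMap A = (hrPairing Φ e σ Ω h2 A A).re := rfl

variable {Φ e σ p q}

/-- **Non-degeneracy of `h_Ω` on `Λ^{p,q}` from mixed hard Lefschetz** (`Ω = θ_1 ∧ ⋯ ∧ θ_n` of type `(n,n)`,
`ε ≠ 0`): if `Ω ∧ · ` is injective on `Λ^{p,q}`, then `h_Ω(A, ·) = 0` on `Λ^{p,q}` forces `A = 0` (T2's
`eq_zero_of_forall_torusIntegral_wedge_conjForm_eq_zero`, Poincaré duality). [cite: DinhNguyen2006, §2 Prop. 2.1 (a) and §4 Remarks 4.2 (arXiv PDF pp. 5, 9)]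
[cite: Cattani2008MixedLefschetz, §2 Def. 2.1 and Thm. 2.2] -/
theorem hrFormPQ_nondegenerate {p q : ℕ} {Θ : Fin n → E [⋀^Fin 2]→L[ℝ] ℂ} (hΘ : ∀ j, IsOfTypeAt 1 1 (Θ j))
    (hΘr : ∀ j, conjForm (Θ j) = Θ j) (hnk : n + k = g) (hpq : p + q = k) (h2 : 2 * n + (k + k) = 2 * g)
    (hσ : conj σ = (-1) ^ k * σ) (hσ0 : σ ≠ 0)
    (hHL : ∀ A ∈ typeSubmodule E k p q, (wedgeFamily n Θ).wedge A = 0 → A = 0) :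
    (hrFormPQ Φ e σ (wedgeFamily n Θ) h2 p q).Nondegenerate := by
  have hleft : ∀ A : ↥((typeSubmodule E k p q).restrictScalars ℝ),
      (∀ B : ↥((typeSubmodule E k p q).restrictScalars ℝ), hrFormPQ Φ e σ (wedgeFamily n Θ) h2 p q A B = 0) →
        A = 0 := fun A hA ↦ by
    have h0 : (A : E [⋀^Fin k]→L[ℝ] ℂ) = 0 :=
      eq_zero_of_forall_torusIntegral_wedge_conjForm_eq_zero Φ e hΘ hnk hpq h2 hHL A.2 fun B hB ↦
        torusIntegral_eq_zero_of_forall_hrForm_eq_zero Φ e σ _ h2 hσ0 (U := typeSubmodule E k p q)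
          (fun B' hB' ↦ hA ⟨B', hB'⟩) hB
    exact Subtype.ext h0
  have hsymm := hrFormPQ_isSymm Φ e σ (wedgeFamily n Θ) h2 p q (conjForm_wedgeFamily_of_real hΘr) hσ
  exact ⟨fun A hA ↦ hleft A hA, fun B hB ↦ hleft B fun A ↦ by rw [hsymm.eq B A]; exact hB A⟩

/-- Hence **the quadratic form `A ↦ H(A, A)` on `Λ^{p,q}` has trivial radical** under mixed hard Lefschetz — the
hypothesis of the signature-constancy theorem `sigPos_eq_of_convex`. [cite: DinhNguyen2006, §2 Prop. 2.1 (a) (arXiv PDF p. 5)]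
[cite: Gregory1980QuadraticForms, Ch. 2 §2.3 Cor. 8 (chunk p0087)] -/
theorem radical_hrFormPQ_eq_bot {p q : ℕ} {Θ : Fin n → E [⋀^Fin 2]→L[ℝ] ℂ} (hΘ : ∀ j, IsOfTypeAt 1 1 (Θ j))
    (hΘr : ∀ j, conjForm (Θ j) = Θ j) (hnk : n + k = g) (hpq : p + q = k) (h2 : 2 * n + (k + k) = 2 * g)
    (hσ : conj σ = (-1) ^ k * σ) (hσ0 : σ ≠ 0)
    (hHL : ∀ A ∈ typeSubmodule E k p q, (wedgeFamily n Θ).wedge A = 0 → A = 0) :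
    (hrFormPQ Φ e σ (wedgeFamily n Θ) h2 p q).toQuadraticMap.radical = ⊥ :=
  Literature.LinearAlgebra.QuadraticForm.radical_toQuadraticMap_eq_bot_of_nondegenerate
    (hrFormPQ_isSymm Φ e σ (wedgeFamily n Θ) h2 p q (conjForm_wedgeFamily_of_real hΘr) hσ).eq
    (hrFormPQ_nondegenerate hΘ hΘr hnk hpq h2 hσ hσ0 hHL)

/-- `Λ^k_ℂ(E)` is finite-dimensional over `ℝ` (for the pointwise real structure; `dim_ℝ = 2 dim_ℂ`).
[cite: Lange2023AbelianVarietiesComplex, §1.1.3 Cor. 1.1.19] -/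
theorem finiteDimensional_real_complexForms [FiniteDimensional ℂ E] {m : ℕ} :
    FiniteDimensional ℝ (E [⋀^Fin m]→L[ℝ] ℂ) :=
  Module.Finite.trans ℂ _

end Restrict

/-! ## §4 Continuity of the form in the background `(θ_1, …, θ_n)` -/

section Continuity

variable {ι : Type*} [DecidableEq ι] {E : Type*} [NormedAddCommGroup E] [NormedSpace ℂ E]
  (Φ : (ι → ℝ) ≃L[ℝ] E) {g n k : ℕ} (e : Fin (2 * g) ≃ ι) (σ : ℂ) (h2 : 2 * n + (k + k) = 2 * g)

omit [DecidableEq ι] in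
/-- `η ↦ η_ℂ` is continuous (an isometric real-linear map). [cite: Lange2023AbelianVarietiesComplex, §1.1.3 Cor. 1.1.19] -/
theorem continuous_ofRealForm {m : ℕ} : Continuous (ofRealForm : (E [⋀^Fin m]→L[ℝ] ℝ) → E [⋀^Fin m]→L[ℝ] ℂ) := by
  let L : (E [⋀^Fin m]→L[ℝ] ℝ) →ₗ[ℝ] (E [⋀^Fin m]→L[ℝ] ℂ) :=
    { toFun := ofRealForm
      map_add' := ofRealForm_add
      map_smul' := fun c η ↦ by
        rw [ofRealForm_smul, RingHom.id_apply]
        ext v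
        simp only [ContinuousAlternatingMap.smul_apply, Complex.real_smul, smul_eq_mul] }
  have hL : Continuous L := by
    refine (L.mkContinuous 1 fun η ↦ ?_).continuous
    rw [one_mul]
    exact (ContinuousLinearMap.norm_compContinuousAlternatingMap_le _ _).trans
      (by rw [Complex.ofRealCLM_norm, one_mul])
  exact hL

omit [DecidableEq ι] in
/-- **The monomial `θ_1 ∧ ⋯ ∧ θ_n` depends continuously on `(θ_1, …, θ_n)`** (`∧` is a bounded bilinear map).
[cite: Gregory1980QuadraticForms, Ch. 2 §2.3 (continuous families of forms; chunk p0086)] [cite: WarnerGTM94, 2.6] -/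
theorem continuous_wedgeFamily {X : Type*} [TopologicalSpace X] :
    ∀ {n : ℕ} {Θ : X → Fin n → E [⋀^Fin 2]→L[ℝ] ℂ}, (∀ j, Continuous fun x ↦ Θ x j) →
      Continuous fun x ↦ wedgeFamily n (Θ x)
  | 0, _, _ => continuous_const
  | n + 1, Θ, hΘ => by
    have h1 : Continuous fun x ↦ wedgeFamily n (Fin.init (Θ x)) :=
      continuous_wedgeFamily (Θ := fun x ↦ Fin.init (Θ x)) fun j ↦ hΘ (Fin.castSucc j)
    have h := ((wedgeCLM ℝ E ℂ (2 * n) 2).continuous.comp h1).clm_apply (hΘ (Fin.last n))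
    simp only [Function.comp_def, wedgeCLM_apply] at h
    exact h

omit [DecidableEq ι] in
/-- The background `Ω(θ) = (-θ_1)_ℂ ∧ ⋯ ∧ (-θ_n)_ℂ` depends continuously on the real `2`-forms `θ_j`.
[cite: Gregory1980QuadraticForms, Ch. 2 §2.3 (chunk p0086)] -/
theorem continuous_wedgeFamily_ofRealForm_neg {X : Type*} [TopologicalSpace X] {n : ℕ}
    {θ : X → Fin n → E [⋀^Fin 2]→L[ℝ] ℝ} (hθ : ∀ j, Continuous fun x ↦ θ x j) :
    Continuous fun x ↦ wedgeFamily n fun j ↦ ofRealForm (-(θ x j)) :=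
  continuous_wedgeFamily fun j ↦ continuous_ofRealForm.comp (hθ j).neg

/-- **The entries `h_{Ω(θ)}(A, B)` are continuous in the background `θ`** — the continuity hypothesis of the
signature-constancy theorem. [cite: Gregory1980QuadraticForms, Ch. 2 §2.3 Thm. 5 and Cor. 8 (chunks p0086–p0087)] -/
theorem continuous_hrForm_wedgeFamily {X : Type*} [TopologicalSpace X] {θ : X → Fin n → E [⋀^Fin 2]→L[ℝ] ℝ}
    (hθ : ∀ j, Continuous fun x ↦ θ x j) (A B : E [⋀^Fin k]→L[ℝ] ℂ) :
    Continuous fun x ↦ hrForm Φ e σ (wedgeFamily n fun j ↦ ofRealForm (-(θ x j))) h2 A B := by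
  have h1 : Continuous fun x ↦ (wedgeFamily n fun j ↦ ofRealForm (-(θ x j))).wedge (A.wedge (conjForm B)) := by
    have h := ((wedgeCLM ℝ E ℂ (2 * n) (k + k)).continuous.comp (continuous_wedgeFamily_ofRealForm_neg hθ)).clm_apply
      (continuous_const (y := A.wedge (conjForm B)))
    simp only [Function.comp_def, wedgeCLM_apply] at h
    exact h
  have h2' : Continuous fun x ↦ ((wedgeFamily n fun j ↦ ofRealForm (-(θ x j))).wedge (A.wedge (conjForm B)))
      (latticeFrame Φ e ∘ Fin.cast h2) := (continuous_eval_const _).comp h1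
  simp only [hrForm_apply, hrPairing_apply, torusIntegral_domDomCongr_latticeFrame]
  exact Complex.continuous_re.comp (continuous_const.mul (continuous_const.mul h2'))

end Continuity

/-! ## §5 Indices of inertia are additive over an orthogonal splitting -/

section Inertia

variable {V : Type*} [AddCommGroup V] [Module ℝ V] [FiniteDimensional ℝ V]

/-- **`b^±(Q) = b^±(Q|W₁) + b^±(Q|W₂)` for a `Q`-orthogonal splitting `V = W₁ ⊕ W₂` of a non-degenerate symmetric
form** (Sylvester: `≤` by the tree's `sigPos_restrict_add_sigPos_restrict_le`, and the four numbers add up to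
`dim W₁ + dim W₂ = dim V = b⁺ + b⁻` because `Q` is non-degenerate on each summand).
[cite: Gregory1980QuadraticForms, Ch. 2 §2.2 Thm. 12 and Thm. 14 (chunks p0077–p0078)] [cite: Serre1973, Ch. IV §2.4] -/
theorem sigPos_sigNeg_eq_add_of_isCompl (B : LinearMap.BilinForm ℝ V) (hB : B.IsSymm) (hnd : B.Nondegenerate)
    {W₁ W₂ : Submodule ℝ V} (hc : IsCompl W₁ W₂) (horth : ∀ x ∈ W₁, ∀ y ∈ W₂, B x y = 0) :
    sigPos B.toQuadraticMap = sigPos (B.toQuadraticMap.restrict W₁) + sigPos (B.toQuadraticMap.restrict W₂) ∧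
      sigNeg B.toQuadraticMap = sigNeg (B.toQuadraticMap.restrict W₁) + sigNeg (B.toQuadraticMap.restrict W₂) := by
  have hp := LinearMap.BilinForm.sigPos_restrict_add_sigPos_restrict_le B hB W₁ W₂ horth
  have hn := LinearMap.BilinForm.sigNeg_restrict_add_sigNeg_restrict_le B hB W₁ W₂ horth
  have hV := Literature.LinearAlgebra.QuadraticForm.sigPos_add_sigNeg_eq_finrank_of_radical_eq_bot
    (Literature.LinearAlgebra.QuadraticForm.radical_toQuadraticMap_eq_bot_of_nondegenerate hB.eq hnd)
  -- `B` is non-degenerate on each summand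
  have hdec : ∀ v : V, ∃ y₁ ∈ W₁, ∃ y₂ ∈ W₂, v = y₁ + y₂ := fun v ↦ by
    have hv : v ∈ W₁ ⊔ W₂ := by rw [hc.sup_eq_top]; exact Submodule.mem_top
    obtain ⟨y₁, hy₁, y₂, hy₂, h⟩ := Submodule.mem_sup.1 hv
    exact ⟨y₁, hy₁, y₂, hy₂, h.symm⟩
  have h1 : ∀ x ∈ W₁, (∀ y ∈ W₁, B x y = 0) → x = 0 := fun x hx h ↦ hnd.1 x fun v ↦ by
    obtain ⟨y₁, hy₁, y₂, hy₂, rfl⟩ := hdec v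
    rw [map_add, h y₁ hy₁, horth x hx y₂ hy₂, add_zero]
  have h2 : ∀ x ∈ W₂, (∀ y ∈ W₂, B x y = 0) → x = 0 := fun x hx h ↦ hnd.1 x fun v ↦ by
    obtain ⟨y₁, hy₁, y₂, hy₂, rfl⟩ := hdec v
    rw [map_add, h y₂ hy₂, ← hB.eq, horth y₁ hy₁ x hx, zero_add]
  have hW₁ := LinearMap.BilinForm.sigPos_add_sigNeg_restrict_eq_finrank_of_forall B hB W₁ h1
  have hW₂ := LinearMap.BilinForm.sigPos_add_sigNeg_restrict_eq_finrank_of_forall B hB W₂ h2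
  have hdim := Submodule.finrank_add_eq_of_isCompl hc
  omega

end Inertia

/-! ## §6 The `h`-orthogonal splitting `Λ^{p+1,q+1} = P^{p+1,q+1} ⊕ ω ∧ Λ^{p,q}` over `ℝ` and its indices -/

section Splitting

variable {ι : Type*} [Fintype ι] [DecidableEq ι] {E : Type*} [NormedAddCommGroup E] [NormedSpace ℂ E]
  (Φ : (ι → ℝ) ≃L[ℝ] E)

/-- **The mixed primitive forms `P_Θ ∩ Λ^{p,q}` as a real subspace of `Λ^{p,q}`.**
[cite: DinhNguyen2006, §2 Prop. 2.1 (c) (arXiv PDF p. 5)] -/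
def primitiveReal {r : ℕ} (Θ : Fin r → E [⋀^Fin 2]→L[ℝ] ℂ) (k p q : ℕ) :
    Submodule ℝ ↥((typeSubmodule E k p q).restrictScalars ℝ) :=
  ((mixedPrimitiveForms Θ k).restrictScalars ℝ).comap ((typeSubmodule E k p q).restrictScalars ℝ).subtype

/-- Membership in `P_Θ ∩ Λ^{p,q}`: `(θ_1 ∧ ⋯ ∧ θ_r) ∧ A = 0`. [cite: DinhNguyen2006, §2 Prop. 2.1 (c) (arXiv PDF p. 5)] -/
theorem mem_primitiveReal {r : ℕ} (Θ : Fin r → E [⋀^Fin 2]→L[ℝ] ℂ) {k p q : ℕ}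
    (A : ↥((typeSubmodule E k p q).restrictScalars ℝ)) :
    A ∈ primitiveReal Θ k p q ↔ (wedgeFamily r Θ).wedge (A : E [⋀^Fin k]→L[ℝ] ℂ) = 0 := by
  rw [primitiveReal, Submodule.mem_comap, Submodule.restrictScalars_mem, Submodule.subtype_apply,
    mem_mixedPrimitiveForms_iff]

/-- Wedge with a fixed `2`-form on the right, `C ↦ C ∧ ω`, as a `ℂ`-linear map. [cite: WarnerGTM94, 2.6] -/
def wedgeRight (ω : E [⋀^Fin 2]→L[ℝ] ℂ) (m : ℕ) : (E [⋀^Fin m]→L[ℝ] ℂ) →ₗ[ℂ] (E [⋀^Fin (m + 2)]→L[ℝ] ℂ) where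
  toFun C := C.wedge ω
  map_add' C C' := ContinuousAlternatingMap.wedge_add_left C C' ω
  map_smul' c C := wedge_smul_left_complex c C ω

/-- Unfolding. [cite: WarnerGTM94, 2.6] -/
@[simp] theorem wedgeRight_apply (ω : E [⋀^Fin 2]→L[ℝ] ℂ) {m : ℕ} (C : E [⋀^Fin m]→L[ℝ] ℂ) :
    wedgeRight ω m C = C.wedge ω := rfl

/-- **The Lefschetz summand `ω ∧ Λ^{p,q} ⊆ Λ^{p+1,q+1}` as a real subspace of `Λ^{p+1,q+1}`.**
[cite: DinhNguyen2006, §2 Prop. 2.1 (c) (arXiv PDF p. 5)] -/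
def lefschetzReal (ω : E [⋀^Fin 2]→L[ℝ] ℂ) (m p q : ℕ) :
    Submodule ℝ ↥((typeSubmodule E (m + 2) (p + 1) (q + 1)).restrictScalars ℝ) :=
  (((typeSubmodule E m p q).map (wedgeRight ω m)).restrictScalars ℝ).comap
    ((typeSubmodule E (m + 2) (p + 1) (q + 1)).restrictScalars ℝ).subtype

/-- Membership in `ω ∧ Λ^{p,q}`. [cite: DinhNguyen2006, §2 Prop. 2.1 (c) (arXiv PDF p. 5)] -/
theorem mem_lefschetzReal (ω : E [⋀^Fin 2]→L[ℝ] ℂ) {m p q : ℕ}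
    (A : ↥((typeSubmodule E (m + 2) (p + 1) (q + 1)).restrictScalars ℝ)) :
    A ∈ lefschetzReal ω m p q ↔ ∃ C ∈ typeSubmodule E m p q, C.wedge ω = (A : E [⋀^Fin (m + 2)]→L[ℝ] ℂ) := by
  rw [lefschetzReal, Submodule.mem_comap, Submodule.restrictScalars_mem, Submodule.subtype_apply, Submodule.mem_map]
  simp only [wedgeRight_apply]

variable [FiniteDimensional ℂ E]

/-- **`Λ^{p+1,q+1} = (P_Θ ∩ Λ^{p+1,q+1}) ⊕ ω ∧ Λ^{p,q}` over `ℝ`** (T2's existence and uniqueness, under mixed hard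
Lefschetz for `(θ_0, …, θ_n, θ_n)` on `Λ^{p,q}`). [cite: DinhNguyen2006, §2 Prop. 2.1 (c) (arXiv PDF p. 5)]
[cite: Cattani2008MixedLefschetz, Thm. 2.2] -/
theorem isCompl_primitiveReal_lefschetzReal {g n m p q : ℕ} (hg : finrank ℂ E = g) (hpq : p + q = m)
    (hnk : n + (m + 2) = g) {Θ : Fin (n + 1) → E [⋀^Fin 2]→L[ℝ] ℂ} (hΘ : ∀ j, IsOfTypeAt 1 1 (Θ j))
    (hHL : ∀ C ∈ typeSubmodule E m p q, (wedgeFamily (n + 2) (Fin.snoc Θ (Θ (Fin.last n)))).wedge C = 0 → C = 0) :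
    IsCompl (primitiveReal Θ (m + 2) (p + 1) (q + 1)) (lefschetzReal (Θ (Fin.last n)) m p q) := by
  refine isCompl_iff.2 ⟨?_, ?_⟩
  · rw [Submodule.disjoint_def]
    intro x hxP hxW
    obtain ⟨C, hC, hCx⟩ := (mem_lefschetzReal _ x).1 hxW
    have hB : (x : E [⋀^Fin (m + 2)]→L[ℝ] ℂ) ∈ mixedPrimitiveForms Θ (m + 2) :=
      (mem_mixedPrimitiveForms_iff Θ _).2 ((mem_primitiveReal Θ x).1 hxP)
    have h := eq_zero_of_mem_mixedPrimitiveForms_of_add_wedge_eq_zero Θ hHL hB (C := -C)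
      ((typeSubmodule E m p q).neg_mem hC) (by
        rw [show -C = (-1 : ℂ) • C by rw [neg_one_smul], wedge_smul_left_complex, hCx, neg_one_smul, add_neg_cancel])
    exact Subtype.ext h.2
  · rw [codisjoint_iff, Submodule.eq_top_iff']
    intro x
    obtain ⟨B, hB, C, hC, hx⟩ := exists_mem_mixedPrimitiveForms_add_wedge_eq hg hpq hnk hΘ hHL x.2
    have hBt : B ∈ typeSubmodule E (m + 2) (p + 1) (q + 1) := (Submodule.mem_inf.1 hB).2
    have hCt : C.wedge (Θ (Fin.last n)) ∈ typeSubmodule E (m + 2) (p + 1) (q + 1) :=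
      wedge_mem_typeSubmodule_succ hpq hC (hΘ _)
    have hx' : x = (⟨B, hBt⟩ : ↥((typeSubmodule E (m + 2) (p + 1) (q + 1)).restrictScalars ℝ)) + ⟨_, hCt⟩ :=
      Subtype.ext hx
    rw [hx']
    refine Submodule.add_mem_sup ((mem_primitiveReal Θ _).2 ?_) ((mem_lefschetzReal _ _).2 ⟨C, hC, rfl⟩)
    exact (mem_mixedPrimitiveForms_iff Θ _).1 (Submodule.mem_inf.1 hB).1

omit [Fintype ι] [FiniteDimensional ℂ E] in
/-- **The splitting is `h`-orthogonal**: `h(B, C ∧ ω) = 0` for `B` primitive (the family real; T2's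
`wedgeFamily_init_wedge_wedge_conjForm_wedge_last_eq_zero`). [cite: DinhNguyen2006, §2 Prop. 2.1 (c) ("`Q`-orthogonal direct sum"; arXiv PDF p. 5)] -/
theorem hrFormPQ_eq_zero_of_mem_primitiveReal_of_mem_lefschetzReal {g n m p q : ℕ} (e : Fin (2 * g) ≃ ι) (σ : ℂ)
    {Θ : Fin (n + 1) → E [⋀^Fin 2]→L[ℝ] ℂ} (hΘr : ∀ j, conjForm (Θ j) = Θ j)
    (h2 : 2 * n + ((m + 2) + (m + 2)) = 2 * g) {x y : ↥((typeSubmodule E (m + 2) (p + 1) (q + 1)).restrictScalars ℝ)}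
    (hx : x ∈ primitiveReal Θ (m + 2) (p + 1) (q + 1)) (hy : y ∈ lefschetzReal (Θ (Fin.last n)) m p q) :
    hrFormPQ Φ e σ (wedgeFamily n (Fin.init Θ)) h2 (p + 1) (q + 1) x y = 0 := by
  obtain ⟨C, -, hCy⟩ := (mem_lefschetzReal _ y).1 hy
  have hB : (x : E [⋀^Fin (m + 2)]→L[ℝ] ℂ) ∈ mixedPrimitiveForms Θ (m + 2) :=
    (mem_mixedPrimitiveForms_iff Θ _).2 ((mem_primitiveReal Θ x).1 hx)
  rw [hrFormPQ_apply, hrPairing_apply, ← hCy, wedgeFamily_init_wedge_wedge_conjForm_wedge_last_eq_zero (hΘr _) hB C,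
    torusIntegral_domDomCongr_latticeFrame, ContinuousAlternatingMap.coe_zero, Pi.zero_apply, mul_zero, mul_zero,
    Complex.zero_re]

/-- **`b^±(h on Λ^{p+1,q+1}) = b^±(h|_P) + b^±(h|_{ω ∧ Λ^{p,q}})`**: the indices of the mixed Hodge–Riemann form
on `Λ^{p+1,q+1}` split along the `h`-orthogonal mixed Lefschetz decomposition (`h` non-degenerate by mixed hard
Lefschetz for `(θ_0, …, θ_{n-1})` on `Λ^{p+1,q+1}`). [cite: DinhNguyen2006, §2 Prop. 2.1 (a), (c) (arXiv PDF p. 5)]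
[cite: Gregory1980QuadraticForms, Ch. 2 §2.2 Thm. 12 (chunk p0077)] -/
theorem sigPos_sigNeg_hrFormPQ_eq_add {g n m p q : ℕ} (hg : finrank ℂ E = g) (hpq : p + q = m) (hnk : n + (m + 2) = g)
    (e : Fin (2 * g) ≃ ι) {σ : ℂ} (hσ : conj σ = (-1) ^ (m + 2) * σ) (hσ0 : σ ≠ 0)
    {Θ : Fin (n + 1) → E [⋀^Fin 2]→L[ℝ] ℂ} (hΘ : ∀ j, IsOfTypeAt 1 1 (Θ j)) (hΘr : ∀ j, conjForm (Θ j) = Θ j)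
    (h2 : 2 * n + ((m + 2) + (m + 2)) = 2 * g)
    (hHL₁ : ∀ A ∈ typeSubmodule E (m + 2) (p + 1) (q + 1), (wedgeFamily n (Fin.init Θ)).wedge A = 0 → A = 0)
    (hHL₂ : ∀ C ∈ typeSubmodule E m p q, (wedgeFamily (n + 2) (Fin.snoc Θ (Θ (Fin.last n)))).wedge C = 0 → C = 0) :
    sigPos (hrFormPQ Φ e σ (wedgeFamily n (Fin.init Θ)) h2 (p + 1) (q + 1)).toQuadraticMap =
        sigPos ((hrFormPQ Φ e σ (wedgeFamily n (Fin.init Θ)) h2 (p + 1) (q + 1)).toQuadraticMap.restrict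
          (primitiveReal Θ (m + 2) (p + 1) (q + 1))) +
        sigPos ((hrFormPQ Φ e σ (wedgeFamily n (Fin.init Θ)) h2 (p + 1) (q + 1)).toQuadraticMap.restrict
          (lefschetzReal (Θ (Fin.last n)) m p q)) ∧
      sigNeg (hrFormPQ Φ e σ (wedgeFamily n (Fin.init Θ)) h2 (p + 1) (q + 1)).toQuadraticMap =
        sigNeg ((hrFormPQ Φ e σ (wedgeFamily n (Fin.init Θ)) h2 (p + 1) (q + 1)).toQuadraticMap.restrict
          (primitiveReal Θ (m + 2) (p + 1) (q + 1))) +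
        sigNeg ((hrFormPQ Φ e σ (wedgeFamily n (Fin.init Θ)) h2 (p + 1) (q + 1)).toQuadraticMap.restrict
          (lefschetzReal (Θ (Fin.last n)) m p q)) := by
  haveI : FiniteDimensional ℝ (E [⋀^Fin (m + 2)]→L[ℝ] ℂ) := finiteDimensional_real_complexForms
  have hΘ' : ∀ j, IsOfTypeAt 1 1 (Fin.init Θ j) := fun j ↦ hΘ _
  have hΘr' : ∀ j, conjForm (Fin.init Θ j) = Fin.init Θ j := fun j ↦ hΘr _
  exact sigPos_sigNeg_eq_add_of_isCompl _
    (hrFormPQ_isSymm Φ e σ _ h2 (p + 1) (q + 1) (conjForm_wedgeFamily_of_real hΘr') hσ)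
    (hrFormPQ_nondegenerate hΘ' hΘr' hnk (by omega) h2 hσ hσ0 hHL₁)
    (isCompl_primitiveReal_lefschetzReal hg hpq hnk hΘ hHL₂)
    fun x hx y hy ↦ hrFormPQ_eq_zero_of_mem_primitiveReal_of_mem_lefschetzReal Φ e σ hΘr h2 hx hy

end Splitting

/-! ## §7 `h` on `ω ∧ Λ^{p,q}` is the degree-`(p+q)` form of the background `(θ_0, …, θ_n, θ_n)` -/

section Transport

variable {ι : Type*} [DecidableEq ι] {E : Type*} [NormedAddCommGroup E] [NormedSpace ℂ E]
  (Φ : (ι → ℝ) ≃L[ℝ] E) {g : ℕ} (e : Fin (2 * g) ≃ ι) (σ : ℂ)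

/-- **`H_{(θ_0, …, θ_{n-1})}(C ∧ ω, C' ∧ ω) = H_{(θ_0, …, θ_n, θ_n)}(C, C')`** (`ω = θ_n` real): the pairing on the
Lefschetz summand is the degree-`(p+q)` pairing of the longer background (T2's
`wedgeFamily_init_wedge_wedge_last_wedge_conjForm_wedge_last`; the sign `ε(k+2) = -ε(k)` is kept outside).
[cite: DinhNguyen2006, §2 Prop. 2.1 (c) and §3 (arXiv PDF pp. 5–7)] -/
theorem hrPairing_wedge_last_wedge_last {n m : ℕ} (Θ : Fin (n + 1) → E [⋀^Fin 2]→L[ℝ] ℂ)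
    (hω : conjForm (Θ (Fin.last n)) = Θ (Fin.last n)) (h2 : 2 * n + ((m + 2) + (m + 2)) = 2 * g)
    (h2' : 2 * (n + 2) + (m + m) = 2 * g) (C C' : E [⋀^Fin m]→L[ℝ] ℂ) :
    hrPairing Φ e σ (wedgeFamily n (Fin.init Θ)) h2 (C.wedge (Θ (Fin.last n))) (C'.wedge (Θ (Fin.last n))) =
      hrPairing Φ e σ (wedgeFamily (n + 2) (Fin.snoc Θ (Θ (Fin.last n)))) h2' C C' := by
  rw [hrPairing_apply, hrPairing_apply, wedgeFamily_init_wedge_wedge_last_wedge_conjForm_wedge_last Θ hω C C'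
    (by omega : 2 * (n + 2) + (m + m) = 2 * n + ((m + 2) + (m + 2))), domDomCongr_finCongr_trans]

/-- **`b^±(h|_{ω ∧ Λ^{p,q}}) = b^±(h^{(p+q)}_{(θ_0, …, θ_n, θ_n)})`**: `C ↦ C ∧ ω` is a real-linear ISOMETRY of
`(Λ^{p,q}, h_{(θ_0,…,θ_n,θ_n)})` onto `(ω ∧ Λ^{p,q}, h_{(θ_0,…,θ_{n-1})})` — injective by mixed hard Lefschetz for
`(θ_0, …, θ_n, θ_n)` on `Λ^{p,q}` — so the indices of inertia agree (Sylvester).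
[cite: DinhNguyen2006, §2 Prop. 2.1 (c) (arXiv PDF p. 5)] [cite: Cattani2008MixedLefschetz, Thm. 2.2] -/
theorem sigPos_sigNeg_restrict_lefschetzReal_eq {n m p q : ℕ} (hpq : p + q = m) {Θ : Fin (n + 1) → E [⋀^Fin 2]→L[ℝ] ℂ}
    (hΘ : ∀ j, IsOfTypeAt 1 1 (Θ j)) (hω : conjForm (Θ (Fin.last n)) = Θ (Fin.last n))
    (h2 : 2 * n + ((m + 2) + (m + 2)) = 2 * g) (h2' : 2 * (n + 2) + (m + m) = 2 * g)
    (hHL₂ : ∀ C ∈ typeSubmodule E m p q, (wedgeFamily (n + 2) (Fin.snoc Θ (Θ (Fin.last n)))).wedge C = 0 → C = 0) :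
    sigPos ((hrFormPQ Φ e σ (wedgeFamily n (Fin.init Θ)) h2 (p + 1) (q + 1)).toQuadraticMap.restrict
        (lefschetzReal (Θ (Fin.last n)) m p q)) =
      sigPos (hrFormPQ Φ e σ (wedgeFamily (n + 2) (Fin.snoc Θ (Θ (Fin.last n)))) h2' p q).toQuadraticMap ∧
    sigNeg ((hrFormPQ Φ e σ (wedgeFamily n (Fin.init Θ)) h2 (p + 1) (q + 1)).toQuadraticMap.restrict
        (lefschetzReal (Θ (Fin.last n)) m p q)) =
      sigNeg (hrFormPQ Φ e σ (wedgeFamily (n + 2) (Fin.snoc Θ (Θ (Fin.last n)))) h2' p q).toQuadraticMap := by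
  -- the map `C ↦ C ∧ ω`, `Λ^{p,q} → ω ∧ Λ^{p,q}`
  let L : ↥((typeSubmodule E m p q).restrictScalars ℝ) →ₗ[ℝ] ↥(lefschetzReal (Θ (Fin.last n)) m p q) :=
    { toFun := fun C ↦ ⟨⟨(C : E [⋀^Fin m]→L[ℝ] ℂ).wedge (Θ (Fin.last n)),
          wedge_mem_typeSubmodule_succ hpq C.2 (hΘ _)⟩, (mem_lefschetzReal _ _).2 ⟨C, C.2, rfl⟩⟩
      map_add' := fun C C' ↦ by
        apply Subtype.ext; apply Subtype.ext
        simp only [Submodule.coe_add, ContinuousAlternatingMap.wedge_add_left]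
      map_smul' := fun c C ↦ by
        apply Subtype.ext; apply Subtype.ext
        simp only [Submodule.coe_smul, RingHom.id_apply, ContinuousAlternatingMap.wedge_smul_left] }
  have hinj : Function.Injective L := by
    rw [injective_iff_map_eq_zero]
    intro C hC
    have h0 : (C : E [⋀^Fin m]→L[ℝ] ℂ).wedge (Θ (Fin.last n)) = 0 :=
      congrArg (fun z : ↥(lefschetzReal (Θ (Fin.last n)) m p q) ↦
        ((z : ↥((typeSubmodule E (m + 2) (p + 1) (q + 1)).restrictScalars ℝ)) : E [⋀^Fin (m + 2)]→L[ℝ] ℂ)) hC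
    have h1 : (wedgeFamily (n + 2) (Fin.snoc Θ (Θ (Fin.last n)))).wedge (C : E [⋀^Fin m]→L[ℝ] ℂ) = 0 :=
      (wedgeFamily_wedge_wedge_last_eq_zero_iff Θ _).1 (by rw [h0, ContinuousAlternatingMap.wedge_zero])
    exact Subtype.ext (hHL₂ _ C.2 h1)
  have hsurj : Function.Surjective L := fun y ↦ by
    obtain ⟨C, hC, hCy⟩ := (mem_lefschetzReal _ _).1 y.2
    exact ⟨⟨C, hC⟩, Subtype.ext (Subtype.ext hCy)⟩
  let Leq := LinearEquiv.ofBijective L ⟨hinj, hsurj⟩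
  have hiso : QuadraticMap.Equivalent
      (hrFormPQ Φ e σ (wedgeFamily (n + 2) (Fin.snoc Θ (Θ (Fin.last n)))) h2' p q).toQuadraticMap
      ((hrFormPQ Φ e σ (wedgeFamily n (Fin.init Θ)) h2 (p + 1) (q + 1)).toQuadraticMap.restrict
        (lefschetzReal (Θ (Fin.last n)) m p q)) :=
    ⟨{ Leq with
        map_app' := fun C ↦ by
          show (hrPairing Φ e σ (wedgeFamily n (Fin.init Θ)) h2 ((C : E [⋀^Fin m]→L[ℝ] ℂ).wedge (Θ (Fin.last n)))
              ((C : E [⋀^Fin m]→L[ℝ] ℂ).wedge (Θ (Fin.last n)))).re =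
            (hrPairing Φ e σ (wedgeFamily (n + 2) (Fin.snoc Θ (Θ (Fin.last n)))) h2' C C).re
          rw [hrPairing_wedge_last_wedge_last Φ e σ Θ hω h2 h2'] }⟩
  exact ⟨hiso.sigPos_eq.symm, hiso.sigNeg_eq.symm⟩

end Transport

/-! ## §8 The classical point: `h` is positive definite on the primitive forms for a constant background -/

section Classical

variable {ι : Type*} [Fintype ι] [DecidableEq ι] {E : Type*} [NormedAddCommGroup E] [NormedSpace ℂ E]
  (Φ : (ι → ℝ) ≃L[ℝ] E) {g : ℕ}

/-- **The classical Hodge–Riemann bilinear relations as positive definiteness**: for the constant background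
`(ω_0, …, ω_0)` of a positive `(1,1)`-form (`ω_0 = (-η)_ℂ`), the form `h = Re(ε(k,p,q) ∫_X ω_0^n ∧ A ∧ B̄)` is
POSITIVE DEFINITE on the primitive forms `P ∩ Λ^{p,q}` (`n + k = g`; Voisin's Thm. 6.32 on a torus, the tree's
`hodgeRiemann_voisin_of_pos`, the primitivity moved to the front by graded commutativity). This is the base point
of the deformation argument. [cite: VoisinHodgeI2002, §6.3.2 Thm. 6.32] [cite: Timorin1998, Main Theorem]
[cite: DinhNguyen2006, §1 Thm. 1.1 / Thm. 1.3 (arXiv PDF p. 3)] -/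
theorem posDef_hrFormPQ_restrict_primitiveReal_const {n k p q : ℕ} (e : Fin (2 * g) ≃ ι) (hnk : n + k = g)
    (hpq : p + q = k) (h2 : 2 * n + (k + k) = 2 * g) {η : E [⋀^Fin 2]→L[ℝ] ℝ}
    (h11 : ∀ u v : E, η ![I • u, I • v] = η ![u, v]) (hpos : ∀ u : E, u ≠ 0 → 0 < η ![I • u, u]) :
    ((hrFormPQ Φ e (hrSign k p q) (wedgeFamily n fun _ ↦ ofRealForm (-η)) h2 p q).toQuadraticMap.restrict
      (primitiveReal (fun _ : Fin (n + 1) ↦ ofRealForm (-η)) k p q)).PosDef := by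
  haveI := finiteDimensional_complex Φ
  intro x hx0
  rw [QuadraticMap.restrict_apply, hrFormPQ_toQuadraticMap_apply]
  have hψ0 : ((x : ↥((typeSubmodule E k p q).restrictScalars ℝ)) : E [⋀^Fin k]→L[ℝ] ℂ) ≠ 0 := fun h ↦
    hx0 (Subtype.ext (Subtype.ext h))
  have hψt : IsOfTypeAt p q ((x : ↥((typeSubmodule E k p q).restrictScalars ℝ)) : E [⋀^Fin k]→L[ℝ] ℂ) :=
    isOfTypeAt_of_mem_typeSubmodule hpq (x : ↥((typeSubmodule E k p q).restrictScalars ℝ)).2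
  have hprim0 := (mem_primitiveReal (fun _ : Fin (n + 1) ↦ ofRealForm (-η)) _).1 x.2
  have hprim : ((x : ↥((typeSubmodule E k p q).restrictScalars ℝ)) : E [⋀^Fin k]→L[ℝ] ℂ).wedge
      (wedgePow (ofRealForm (-η)) (n + 1)) = 0 := by
    rw [wedgePow, ContinuousAlternatingMap.WedgeComm_holds ℝ E ℂ (wedgeFamily (n + 1) fun _ ↦ ofRealForm (-η)), hprim0,
      (domDomCongr_finCongr_eq_zero_iff _).2 rfl, smul_zero]
  obtain ⟨c, hc, hval⟩ := hodgeRiemann_voisin_of_pos Φ h11 hpos e (k := k) (p := p) (q := q) (r := n) (by omega)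
    h2 hψt hprim hψ0
  rw [wedgePow] at hval
  rw [hrPairing_apply, hrSign_eq_zpow, hval, Complex.ofReal_re]
  exact hc

end Classical

/-! ## §9 Real dimensions; the bidegrees `(0, q)` and `(p, 0)`, where every form is primitive -/

section Dimensions

variable {E : Type*} [NormedAddCommGroup E] [NormedSpace ℂ E] [FiniteDimensional ℂ E]

/-- `dim_ℝ S = 2 dim_ℂ S` for a complex subspace of complex-valued forms read as a real subspace.
[cite: Lange2023AbelianVarietiesComplex, §1.1.3 Cor. 1.1.19] -/
theorem finrank_real_restrictScalars {k : ℕ} (S : Submodule ℂ (E [⋀^Fin k]→L[ℝ] ℂ)) :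
    finrank ℝ ↥(S.restrictScalars ℝ) = 2 * finrank ℂ ↥S := by
  let L : ↥(S.restrictScalars ℝ) ≃ₗ[ℝ] ↥S :=
    { toFun := fun x ↦ ⟨x.1, x.2⟩
      map_add' := fun _ _ ↦ rfl
      map_smul' := fun _ _ ↦ rfl
      invFun := fun y ↦ ⟨y.1, y.2⟩
      left_inv := fun _ ↦ rfl
      right_inv := fun _ ↦ rfl }
  rw [L.finrank_eq, ← Module.finrank_mul_finrank ℝ ℂ ↥S, Complex.finrank_real_complex]

/-- `dim_ℝ Λ^{p,q} = 2 C(g,p) C(g,q)`. [cite: Lange2023AbelianVarietiesComplex, §1.1.5 Prop. 1.1.23] -/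
theorem finrank_typeSubmodule_real {g k p q : ℕ} (hg : finrank ℂ E = g) (hpq : p + q = k) :
    finrank ℝ ↥((typeSubmodule E k p q).restrictScalars ℝ) = 2 * (g.choose p * g.choose q) := by
  rw [finrank_real_restrictScalars, Literature.Analysis.Complex.finrank_typeSubmodule hpq, hg]

/-- `P_Θ ∩ Λ^{p,q}` over `ℝ` is `(P_Θ ⊓ Λ^{p,q})` read as a real space: same dimension.
[cite: DinhNguyen2006, §2 Prop. 2.1 (c) (arXiv PDF p. 5)] -/
theorem finrank_primitiveReal_eq {r k p q : ℕ} (Θ : Fin r → E [⋀^Fin 2]→L[ℝ] ℂ) :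
    finrank ℝ ↥(primitiveReal Θ k p q) = 2 * finrank ℂ ↥(mixedPrimitiveForms Θ k ⊓ typeSubmodule E k p q) := by
  let L : ↥(primitiveReal Θ k p q) ≃ₗ[ℝ] ↥((mixedPrimitiveForms Θ k ⊓ typeSubmodule E k p q).restrictScalars ℝ) :=
    { toFun := fun x ↦ ⟨x.1.1, ⟨x.2, x.1.2⟩⟩
      map_add' := fun _ _ ↦ rfl
      map_smul' := fun _ _ ↦ rfl
      invFun := fun y ↦ ⟨⟨y.1, y.2.2⟩, y.2.1⟩
      left_inv := fun _ ↦ rfl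
      right_inv := fun _ ↦ rfl }
  rw [L.finrank_eq, finrank_real_restrictScalars]

/-- **`dim_ℝ (P_Θ ∩ Λ^{p+1,q+1}) = 2 (C(g,p+1) C(g,q+1) - C(g,p) C(g,q))`** under mixed hard Lefschetz for
`(θ_0, …, θ_n, θ_n)` on `Λ^{p,q}` (T2's `finrank_mixedPrimitiveForms_inf_typeSubmodule`) — INDEPENDENT of the
background, which is what the deformation argument needs. [cite: DinhNguyen2006, §2 Prop. 2.1 (c) (arXiv PDF p. 5)]
[cite: VoisinHodgeI2002, §6.2.3 Cor. 6.25 / Rem. 6.26] -/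
theorem finrank_primitiveReal_succ_succ {g n m p q : ℕ} (hg : finrank ℂ E = g) (hpq : p + q = m)
    (hnk : n + (m + 2) = g) {Θ : Fin (n + 1) → E [⋀^Fin 2]→L[ℝ] ℂ} (hΘ : ∀ j, IsOfTypeAt 1 1 (Θ j))
    (hHL : ∀ C ∈ typeSubmodule E m p q, (wedgeFamily (n + 2) (Fin.snoc Θ (Θ (Fin.last n)))).wedge C = 0 → C = 0) :
    finrank ℝ ↥(primitiveReal Θ (m + 2) (p + 1) (q + 1)) =
      2 * (g.choose (p + 1) * g.choose (q + 1) - g.choose p * g.choose q) := by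
  rw [finrank_primitiveReal_eq, finrank_mixedPrimitiveForms_inf_typeSubmodule hg hpq hnk hΘ hHL]

/-- **In bidegree `(0, q)` every form is primitive**: `(θ_0 ∧ ⋯ ∧ θ_n) ∧ A` has type `(n+1, n+1+q)` and
`n + 1 + q > dim E`. [cite: VoisinHodgeI2002, §6.2.3 (Lefschetz decomposition; forms of type `(p,q)` vanish for `q > n`)] -/
theorem primitiveReal_eq_top_of_fst_eq_zero {g n k : ℕ} (hg : finrank ℂ E = g) (hnk : n + k = g)
    {Θ : Fin (n + 1) → E [⋀^Fin 2]→L[ℝ] ℂ} (hΘ : ∀ j, IsOfTypeAt 1 1 (Θ j)) :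
    primitiveReal Θ k 0 k = ⊤ := by
  rw [Submodule.eq_top_iff']
  intro A
  rw [mem_primitiveReal]
  have ht : IsOfTypeAt (n + 1 + 0) (n + 1 + k) ((wedgeFamily (n + 1) Θ).wedge (A : E [⋀^Fin k]→L[ℝ] ℂ)) :=
    (isOfTypeAt_wedgeFamily hΘ).wedge (isOfTypeAt_of_mem_typeSubmodule (zero_add k) A.2)
  have h := (isOfTypeAt_conjForm ht).eq_zero_of_finrank_lt_fst (by rw [hg]; omega)
  rwa [conj_eq_zero_iff] at h

/-- **In bidegree `(p, 0)` every form is primitive.** [cite: VoisinHodgeI2002, §6.2.3] -/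
theorem primitiveReal_eq_top_of_snd_eq_zero {g n k : ℕ} (hg : finrank ℂ E = g) (hnk : n + k = g)
    {Θ : Fin (n + 1) → E [⋀^Fin 2]→L[ℝ] ℂ} (hΘ : ∀ j, IsOfTypeAt 1 1 (Θ j)) :
    primitiveReal Θ k k 0 = ⊤ := by
  rw [Submodule.eq_top_iff']
  intro A
  rw [mem_primitiveReal]
  have ht : IsOfTypeAt (n + 1 + k) (n + 1 + 0) ((wedgeFamily (n + 1) Θ).wedge (A : E [⋀^Fin k]→L[ℝ] ℂ)) :=
    (isOfTypeAt_wedgeFamily hΘ).wedge (isOfTypeAt_of_mem_typeSubmodule (add_zero k) A.2)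
  exact ht.eq_zero_of_finrank_lt_fst (by rw [hg]; omega)

end Dimensions

/-! ## §10 Sign change `ε ↦ -ε`; positivity of `H(A, A)` read on complex frames -/

section Positivity

variable {ι : Type*} [Fintype ι] [DecidableEq ι] {E : Type*} [NormedAddCommGroup E] [NormedSpace ℂ E]
  (Φ : (ι → ℝ) ≃L[ℝ] E) {g n k : ℕ} (e : Fin (2 * g) ≃ ι) (σ : ℂ) (Ω : E [⋀^Fin (2 * n)]→L[ℝ] ℂ)
  (h2 : 2 * n + (k + k) = 2 * g)

omit [Fintype ι] in
/-- `H_{-ε} = -H_ε`. [cite: VoisinHodgeI2002, §6.3.2 Thm. 6.32 and Rem. 6.34 (alternating signs)] -/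
theorem hrPairing_neg_sign (A B : E [⋀^Fin k]→L[ℝ] ℂ) :
    hrPairing Φ e (-σ) Ω h2 A B = -hrPairing Φ e σ Ω h2 A B := by
  rw [hrPairing_apply, hrPairing_apply, neg_mul]

omit [Fintype ι] in
/-- `h_{-ε}|_{Λ^{p,q}} = -h_ε|_{Λ^{p,q}}`, so `b⁺(h_{-ε}) = b⁻(h_ε)` (`sigPos_neg`).
[cite: VoisinHodgeI2002, §6.3.2 Thm. 6.32 and Rem. 6.34] -/
theorem hrFormPQ_neg_sign (p q : ℕ) : hrFormPQ Φ e (-σ) Ω h2 p q = -hrFormPQ Φ e σ Ω h2 p q := by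
  refine LinearMap.ext fun A ↦ LinearMap.ext fun B ↦ ?_
  rw [hrFormPQ_apply, hrPairing_neg_sign, Complex.neg_re, LinearMap.neg_apply, LinearMap.neg_apply, hrFormPQ_apply]

omit [Fintype ι] in
/-- The quadratic forms: `(h_{-ε}|_{Λ^{p,q}})^{quad} = -(h_ε|_{Λ^{p,q}})^{quad}`. [cite: VoisinHodgeI2002, §6.3.2 Rem. 6.34] -/
theorem hrFormPQ_toQuadraticMap_neg_sign (p q : ℕ) :
    (hrFormPQ Φ e (-σ) Ω h2 p q).toQuadraticMap = -(hrFormPQ Φ e σ Ω h2 p q).toQuadraticMap := by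
  rw [hrFormPQ_neg_sign]
  rfl

omit [Fintype ι] in
/-- **`H(A, A) > 0` (in `ℂ`) iff `h(A, A) > 0`** (`H(A, A)` is real). [cite: DinhNguyen2006, §2 Prop. 2.1 (b) (arXiv PDF p. 5)] -/
theorem hrPairing_self_pos_iff (hΩ : conjForm Ω = Ω) (hσ : conj σ = (-1) ^ k * σ) (A : E [⋀^Fin k]→L[ℝ] ℂ) :
    0 < hrPairing Φ e σ Ω h2 A A ↔ 0 < hrForm Φ e σ Ω h2 A A := by
  rw [hrPairing_self_eq Φ e σ Ω h2 hΩ hσ, Complex.zero_lt_real]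

/-- **`ε · (Ω ∧ A ∧ Ā)(u_1, iu_1, …, u_g, iu_g) > 0` iff `H(A, A) > 0`**, for every complex basis `u`: a top form
read on a complex orientation frame is `∫_X` of it times the positive volume of the frame
(`apply_interleave_eq_torusIntegral_mul`). So the Hodge–Riemann inequality may be stated on frames, free of the
lattice. [cite: Lange2023AbelianVarietiesComplex, §1.7.2 Lemma 1.7.5 (proof: the natural positive orientation) and §2.2.1 proof of Lemma 2.2.2]
[cite: DinhNguyen2006, §2 Prop. 2.1 (b) (arXiv PDF p. 5)] -/
theorem hrSign_mul_apply_interleave_pos_iff (u : Module.Basis (Fin g) ℂ E) (A : E [⋀^Fin k]→L[ℝ] ℂ) :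
    0 < σ * (Ω.wedge (A.wedge (conjForm A)))
        ((fun i ↦ Sum.elim (⇑u) (fun j ↦ I • u j) (finTwoMulEquivSum g i)) ∘ Fin.cast h2) ↔
      0 < hrPairing Φ e σ Ω h2 A A := by
  obtain ⟨ρ, hρ, hvol⟩ := exists_volumeForm_apply_interleave_eq Φ e u
  have h := apply_interleave_eq_torusIntegral_mul Φ e u ((Ω.wedge (A.wedge (conjForm A))).domDomCongr (finCongr h2))
  rw [hvol, ContinuousAlternatingMap.domDomCongr_apply] at h
  have hcast : ((fun i ↦ Sum.elim (⇑u) (fun j ↦ I • u j) (finTwoMulEquivSum g i)) ∘ ⇑(finCongr h2)) =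
      ((fun i ↦ Sum.elim (⇑u) (fun j ↦ I • u j) (finTwoMulEquivSum g i)) ∘ Fin.cast h2) := rfl
  rw [hcast] at h
  rw [h, hrPairing_apply, ← mul_assoc, Complex.lt_def, Complex.lt_def]
  simp only [Complex.zero_re, Complex.zero_im, Complex.mul_re, Complex.mul_im, Complex.ofReal_re, Complex.ofReal_im,
    mul_zero, sub_zero, zero_add, mul_pos_iff_of_pos_right hρ]
  rw [eq_comm, mul_eq_zero, or_iff_left hρ.ne', eq_comm]

end Positivity

end ComplexTorus

end Literature.Geometry.Kaehler

end
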